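import Summits.QuantumFields.YangMills.Theorems.BalabanUVNodesN15KingModelCurvaturePlaquette
import HarnessLib

/-!
# BalabanUVNodes ∕ N15 — THE KING-MODEL RUNG (PART Ϳ-c): THE `U(1)` READING AND THE CONSTANT-FLUX FIELD — at a `U(1)` link field the plaquette hypothesis is `Re P_U(x,ν₀,ν₁) ≤ γ`; at
# 't Hooft's constant-flux field (Ͻ-q `fluxLink p ν₁`, plaquette `χ_p(e_{ν₀}) = e^{iθ}`, `θ = p′_{ν₀} ∈ (−π,π]`) the covariant Laplacian acquires the CURVATURE MASS
# `−cΔ_U ≥ 2c(2 − 2cos(θ∕4)) ≥ cθ²∕(2π²)`, the massless covariance exists with `‖(−cΔ_U)⁻¹‖ ≤ (2c(2−2cos(θ∕4)))⁻¹` — the first NON-FLAT background of the rung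
# (Track A, DAG node N15 = NE2; FAN-OUT v1.1 §N15 s3 «KING-MODEL RUNG … + what the curved case adds»; count-neutral)

HONEST FRAMING.  Count-neutral (cell `pub-ymgap`, seat `pub-ymgap-dag-n15-e` g46; `--supports stmt-QuantumFields-27247 --as helper` = K3ᴬ, KEY MAP v3).  King's fine covariance layer
`−cΔ_U+m²` (Ͱ-a `covLapF`) at `U(1)` link fields on ONE finite torus; elementary; NOT Bałaban's `G_k(U)`; NOT [Balaban1985BackgroundPropagators] (3.42); NOT a node discharge (N15 of
record untouched); nothing continuum ∕ ℝ⁴ ∕ OS ∕ Clay.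

THE RESULTS (`K` any period vector, `c ≥ 0`; `P_U` = Ͻ-q `kingPlaq`; `λ = plaqGap` of Ϳ-a):
* §1 (`U(1)`, fibre `𝕜`) `toEuclideanLin_unit_eq_smul` (a `1 × 1` matrix acts by its entry), ★ `re_inner_plaq_unit` (`Re⟪u, P u⟫ = Re P·‖u‖²`: the numerical-range hypothesis of Ϳ-b holds
  with `γ = Re P_U(x,ν₀,ν₁)`, with equality), ★★ **`re_quadForm_covLapF_ge_plaq_unit`** (`∀ x, Re P_U(x,ν₀,ν₁) ≤ γ` ⟹ `(m² + 2cλ(γ))Σ|v_x|² ≤ Re⟨v,(−cΔ_U+m²)v⟩`), `plaqGap_pos_of_lt_one`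
  (`γ < 1 ⟹ λ(γ) > 0`);
* §2 THE CONSTANT-FLUX FIELD `U = fluxLink K p ν₁` (`U(x,ν₁) = χ_p(x)`, other links `1`): `re_kingPlaq_fluxLink` (`Re P_U(x,ν₀,ν₁) = cos p′_{ν₀}`, `p′ = sOf K p`, EVERY site — constant
  curvature), ★★★ **`re_quadForm_covLapF_fluxLink_ge`** (`(m² + 2c(2 − 2cos(p′_{ν₀}∕4)))·Σ|v_x|² ≤ Re⟨v,(−cΔ_U+m²)v⟩`, `ν₀ ≠ ν₁`), ★★ `eigenvalues_covLapF_fluxLink_ge`, ★★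
  **`fluxGap_pos`** (`p_{ν₀} ≠ 0 ⟹ 2 − 2cos(p′_{ν₀}∕4) > 0`), ★★★ **`posDef_covLapF_fluxLink_massless`** (the MASSLESS `−cΔ_U` is positive definite at non-zero flux, `c > 0` — contrast Ͱ-d
  `not_posDef_covLapF_massless_free` at `U ≡ 1`), ★★★ **`l2_opNorm_covLapF_fluxLink_inv_le`** (`‖(−cΔ_U+m²)⁻¹‖_{ℓ²→ℓ²} ≤ (m² + 2c(2−2cos(p′_{ν₀}∕4)))⁻¹`, any `m² ≥ 0` incl. `0`),
  `fluxGap_ge_sq` (`2−2cos(p′∕4) ≥ p′²∕(4π²)`: the curvature mass is `≥ c·p′²∕(2π²)`);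
* §3 CONTRAST WITH THE FLAT SECTOR: `re_kingPlaq_toronLink` (torons: `Re P = 1`, `λ(1) = 0` — the plaquette road gives nothing on PARTS Ͷ∕Ͻ's sector, correctly: the toron gap is the
  global `2cΣ(1−cos(θ_μ∕K_μ)) → 0`, Ͷ-d), `re_kingPlaq_free`.
WHAT THE CURVED CASE ADDS (as theorems): a uniform magnetic flux `θ` per plaquette gives King's fine covariance a mass `≥ 2c(2−2cos(θ∕4))` that NO flat background has (torons: `λ = 0`;
`U ≡ 1`: massless operator singular) — curvature acts as an infrared regulator, volume-independently.  Sharpness at `θ = π` is Ϳ-d.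
PRIOR TREE ART (by name, not restated): Ϳ-a (`plaqGap`, `plaqGap_cos`, `plaqGap_cos_ge_sq`, `plaqGap_one`, `re_inner_smul_self`), Ϳ-b (`re_quadForm_covLapF_ge_plaq`, `eigenvalues_covLapF_ge_plaq`,
`posDef_covLapF_of_plaq`, `l2_opNorm_covLapF_inv_le_of_plaq`), Ͱ-a (`covLapF`), Ͱ-b (`fib`), Ͷ-a (`toronLink`), Ͻ-q (`kingPlaq`, `fluxLink`, `kingPlaq_fluxLink`, `fluxLink_mem_unitaryGroup`,
`kingPlaq_toronLink`, `kingPlaq_free`), `King1986.Torus.chi_unitVec_eq_exp`, `B5Prop11Plancherel` (`sOf`, `abs_sOf_le`), Mathlib (`Real.cos_eq_one_iff_of_lt_of_lt`).  Dedup (rg at filing): basename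
0 files; needles `re_inner_plaq_unit|re_kingPlaq_fluxLink|re_quadForm_covLapF_fluxLink_ge|fluxGap_pos|posDef_covLapF_fluxLink_massless|l2_opNorm_covLapF_fluxLink_inv_le` 0 tree files.
Locators: [tHooft1979Flux] NPB 153 (flux sectors ∕ twisted b.c., notion only); [DodziukMathai2006] §1 Cor 1.3; [Balaban1985BackgroundPropagators] (3.23) p.394, (3.39) p.397; [King1986] (2.12)
p.653, (4.4) p.670; [Balaban1984PropagatorsI] (1.29)–(1.31) p.23 (`p′`).  0 `sorry`, 0 `def`.
-/

noncomputable section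
open scoped BigOperators ComplexConjugate ComplexOrder InnerProductSpace
open Finset Matrix WithLp

namespace Summit.QuantumFields.YangMills.BalabanUVNodes.N15KingModelRung.Curvature

open Literature.MathematicalPhysics.QuantumFieldTheory.LatticeDiamagneticInequality (Hopping)
open Literature.MathematicalPhysics.QuantumFieldTheory.Balaban1983to89.B5Prop11Plancherel (Tor unitVec chi sOf abs_sOf_le)
open Literature.MathematicalPhysics.QuantumFieldTheory.King1986.Torus (chi_unitVec_eq_exp)
open Summit.QuantumFields.YangMills.BalabanUVNodes.N15KingModelRung.Covariant (covLapF fib fib_apply isHermitian_covLapF)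
open Summit.QuantumFields.YangMills.BalabanUVNodes.N15KingModelRung.Toron (toronLink)
open Summit.QuantumFields.YangMills.BalabanUVNodes.N15KingModelRung.Cover (kingPlaq fluxLink kingPlaq_fluxLink fluxLink_mem_unitaryGroup kingPlaq_toronLink kingPlaq_free)

variable {d : ℕ} (K : Fin (d + 1) → ℕ)

/-! ## §1 `U(1)` links: the hypothesis is `Re P ≤ γ` -/

section Unit1

variable {𝕜 : Type*} [RCLike 𝕜]

/-- A `1 × 1` matrix acts on `EuclideanSpace 𝕜 Unit` by its entry: `toEuclideanLin W u = W()()•u`. [folklore] -/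
theorem toEuclideanLin_unit_eq_smul (W : Matrix Unit Unit 𝕜) (u : EuclideanSpace 𝕜 Unit) : Matrix.toEuclideanLin W u = W () () • u := by
  ext i
  obtain rfl : i = () := rfl
  rw [Matrix.toLpLin_apply, PiLp.toLp_apply, Matrix.mulVec, dotProduct, Fintype.sum_unique, PiLp.smul_apply, smul_eq_mul]

/-- ★ THE `U(1)` READING: `Re⟪u, P u⟫ = Re P·‖u‖²` for a `1 × 1` holonomy `P` — Ϳ-b's numerical-range hypothesis holds with `γ = Re P` (EQUALITY; for `P = e^{iθ}`, `γ = cos θ`). [folklore] -/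
theorem re_inner_plaq_unit (W : Matrix Unit Unit 𝕜) (u : EuclideanSpace 𝕜 Unit) : RCLike.re ⟪u, Matrix.toEuclideanLin W u⟫_𝕜 = RCLike.re (W () ()) * ‖u‖ ^ 2 := by
  rw [toEuclideanLin_unit_eq_smul, re_inner_smul_self]

variable [hK : ∀ μ, NeZero (K μ)] {c : ℝ}

/-- ★★ **PLAQUETTE COERCIVITY FOR `U(1)` LINK FIELDS**: if `Re P_U(x,ν₀,ν₁) ≤ γ` at every site (`ν₀ ≠ ν₁`, `c ≥ 0`), then `(m² + 2c·λ(γ))·Σ_x|v_x|² ≤ Re⟨v,(−cΔ_U+m²)v⟩`.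
[cite: DodziukMathai2006, Cor 1.3 §1; Balaban1985BackgroundPropagators, (3.23) p.394; King1986, (4.4) p.670] -/
theorem re_quadForm_covLapF_ge_plaq_unit (hc : 0 ≤ c) (m2 : ℝ) {U : Tor K × Fin (d + 1) → Matrix Unit Unit 𝕜} (hU : ∀ b, U b ∈ Matrix.unitaryGroup Unit 𝕜) {ν₀ ν₁ : Fin (d + 1)}
    (hν : ν₀ ≠ ν₁) {γ : ℝ} (hγ : ∀ x, RCLike.re (kingPlaq K U x ν₀ ν₁ () ()) ≤ γ) (v : Tor K × Unit → 𝕜) :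
    (m2 + 2 * c * plaqGap γ) * ∑ x, ‖fib K v x‖ ^ 2 ≤ RCLike.re (star v ⬝ᵥ (covLapF K c m2 U *ᵥ v)) :=
  re_quadForm_covLapF_ge_plaq K hc m2 hU hν (fun x u => by rw [re_inner_plaq_unit]; exact mul_le_mul_of_nonneg_right (hγ x) (sq_nonneg _)) v

omit hK in
/-- `γ < 1 ⟹ λ(γ) > 0`: ANY uniform non-flatness gives a positive gap. [folklore] -/
theorem plaqGap_pos_of_lt_one {γ : ℝ} (h : γ < 1) : 0 < plaqGap γ := by
  unfold plaqGap
  have h1 : Real.sqrt (2 + 2 * γ) < 2 := (Real.sqrt_lt' (by norm_num)).mpr (by linarith)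
  have h2 : Real.sqrt (2 + Real.sqrt (2 + 2 * γ)) < 2 := (Real.sqrt_lt' (by norm_num)).mpr (by linarith)
  linarith

end Unit1

/-! ## §2 The constant-flux field -/

section Flux

variable [hK : ∀ μ, NeZero (K μ)] {c : ℝ}

/-- ★ **CONSTANT CURVATURE**: the `(ν₀,ν₁)`-plaquette of the flux field has real part `cos p′_{ν₀}` at EVERY site (`P = χ_p(e_{ν₀}) = e^{ip′_{ν₀}}`, Ͻ-q `kingPlaq_fluxLink` and
`King1986.Torus.chi_unitVec_eq_exp`; `p′ = sOf K p ∈ (−π,π]`). [cite: tHooft1979Flux, NPB 153 (flux sectors, notion); King1986, (2.12) p.653; Balaban1984PropagatorsI, (1.29) p.23] -/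
theorem re_kingPlaq_fluxLink (p : Tor K) {ν₀ ν₁ : Fin (d + 1)} (hν : ν₀ ≠ ν₁) (x : Tor K) :
    RCLike.re (kingPlaq K (fluxLink K p ν₁) x ν₀ ν₁ () ()) = Real.cos (sOf K p ν₀) := by
  rw [kingPlaq_fluxLink K p hν x, Matrix.of_apply, chi_unitVec_eq_exp]
  exact Complex.exp_ofReal_mul_I_re _

/-- ★★★ **THE CURVATURE MASS OF THE CONSTANT-FLUX FIELD**: for `U = fluxLink K p ν₁`, `ν₀ ≠ ν₁`, `c ≥ 0` and every `m²`:
`(m² + 2c·(2 − 2cos(p′_{ν₀}∕4)))·Σ_x|v_x|² ≤ Re⟨v, (−cΔ_U+m²)v⟩` — a uniform magnetic flux `θ = p′_{ν₀}` through the `(ν₀,ν₁)`-plaquettes lifts the bottom of King's covariant kinetic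
spectrum by `2c(2−2cos(θ∕4))` (Ϳ-b at `γ = cos θ`, Ϳ-a `plaqGap_cos` with `|θ| ≤ π`). [cite: DodziukMathai2006, Cor 1.3 §1; tHooft1979Flux, NPB 153 (flux sectors, notion); King1986, (4.4) p.670] -/
theorem re_quadForm_covLapF_fluxLink_ge (hc : 0 ≤ c) (m2 : ℝ) (p : Tor K) {ν₀ ν₁ : Fin (d + 1)} (hν : ν₀ ≠ ν₁) (v : Tor K × Unit → ℂ) :
    (m2 + 2 * c * (2 - 2 * Real.cos (sOf K p ν₀ / 4))) * ∑ x, ‖fib K v x‖ ^ 2 ≤ (star v ⬝ᵥ (covLapF K c m2 (fluxLink K p ν₁) *ᵥ v)).re := by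
  have h := re_quadForm_covLapF_ge_plaq_unit K hc m2 (fluxLink_mem_unitaryGroup K p ν₁) hν (γ := Real.cos (sOf K p ν₀)) (fun x => (re_kingPlaq_fluxLink K p hν x).le) v
  rwa [plaqGap_cos (abs_sOf_le K p ν₀)] at h

/-- ★★ Every eigenvalue of `−cΔ_U + m²` at the flux field is `≥ m² + 2c(2 − 2cos(p′_{ν₀}∕4))`. [cite: DodziukMathai2006, Cor 1.3 §1; King1986, (4.4) p.670] -/
theorem eigenvalues_covLapF_fluxLink_ge (hc : 0 ≤ c) (m2 : ℝ) (p : Tor K) {ν₀ ν₁ : Fin (d + 1)} (hν : ν₀ ≠ ν₁) (i : Tor K × Unit) :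
    m2 + 2 * c * (2 - 2 * Real.cos (sOf K p ν₀ / 4)) ≤ (isHermitian_covLapF K c m2 (fluxLink K p ν₁)).eigenvalues i := by
  have h := eigenvalues_covLapF_ge_plaq K hc m2 (fluxLink_mem_unitaryGroup K p ν₁) hν (γ := Real.cos (sOf K p ν₀))
    (fun x u => by rw [re_inner_plaq_unit]; exact mul_le_mul_of_nonneg_right (re_kingPlaq_fluxLink K p hν x).le (sq_nonneg _)) i
  rwa [plaqGap_cos (abs_sOf_le K p ν₀)] at h

/-- `p_{ν₀} ≠ 0 ⟹ cos p′_{ν₀} < 1` (`p′ ∈ (−π,π]`, non-zero). [folklore] -/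
theorem cos_sOf_lt_one {p : Tor K} {ν₀ : Fin (d + 1)} (hp : p ν₀ ≠ 0) : Real.cos (sOf K p ν₀) < 1 := by
  have hπ := abs_sOf_le K p ν₀
  have hne : sOf K p ν₀ ≠ 0 := by
    unfold sOf
    have hK0 : (0 : ℝ) < K ν₀ := by exact_mod_cast Nat.pos_of_ne_zero (NeZero.ne _)
    have hv : ((p ν₀).valMinAbs : ℝ) ≠ 0 := by exact_mod_cast (ZMod.valMinAbs_eq_zero (p ν₀)).not.mpr hp
    have : 2 * Real.pi * ((p ν₀).valMinAbs : ℝ) ≠ 0 := mul_ne_zero (by positivity) hv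
    exact div_ne_zero this hK0.ne'
  have hlt : Real.cos (sOf K p ν₀) ≠ 1 := fun h1 =>
    hne ((Real.cos_eq_one_iff_of_lt_of_lt (by linarith [abs_le.mp hπ, Real.pi_pos]) (by linarith [abs_le.mp hπ, Real.pi_pos])).mp h1)
  exact lt_of_le_of_ne (Real.cos_le_one _) hlt

/-- ★★ **THE FLUX GAP IS POSITIVE**: `p_{ν₀} ≠ 0 ⟹ 0 < 2 − 2cos(p′_{ν₀}∕4)`. [folklore] -/
theorem fluxGap_pos {p : Tor K} {ν₀ : Fin (d + 1)} (hp : p ν₀ ≠ 0) : 0 < 2 - 2 * Real.cos (sOf K p ν₀ / 4) := by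
  rw [← plaqGap_cos (abs_sOf_le K p ν₀)]
  exact plaqGap_pos_of_lt_one (cos_sOf_lt_one K hp)

/-- `2 − 2cos(p′∕4) ≥ p′²∕(4π²)` (Ϳ-a `plaqGap_cos_ge_sq`): the curvature mass is at least `c·p′²∕(2π²)`. [folklore] -/
theorem fluxGap_ge_sq (p : Tor K) (ν₀ : Fin (d + 1)) : (sOf K p ν₀) ^ 2 / (4 * Real.pi ^ 2) ≤ 2 - 2 * Real.cos (sOf K p ν₀ / 4) := by
  rw [← plaqGap_cos (abs_sOf_le K p ν₀)]
  exact plaqGap_cos_ge_sq (abs_sOf_le K p ν₀)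

/-- ★★★ **THE MASSLESS COVARIANT LAPLACIAN AT NON-ZERO FLUX IS POSITIVE DEFINITE** (`c > 0`, `p_{ν₀} ≠ 0`, `ν₀ ≠ ν₁`): curvature is an infrared regulator (contrast PART Ͱ-d
`not_posDef_covLapF_massless_free`: at `U ≡ 1` the constants are zero modes; PART Ͷ-d: torons need a non-trivial HOLONOMY and their gap vanishes with the volume).
[cite: DodziukMathai2006, Cor 1.3 §1; tHooft1979Flux, NPB 153 (flux sectors, notion); Balaban1985BackgroundPropagators, (3.23) p.394] -/
theorem posDef_covLapF_fluxLink_massless (hc : 0 < c) {p : Tor K} {ν₀ ν₁ : Fin (d + 1)} (hν : ν₀ ≠ ν₁) (hp : p ν₀ ≠ 0) :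
    (covLapF K c 0 (fluxLink K p ν₁)).PosDef := by
  refine posDef_covLapF_of_plaq K hc.le (fluxLink_mem_unitaryGroup K p ν₁) hν (γ := Real.cos (sOf K p ν₀))
    (fun x u => by rw [re_inner_plaq_unit]; exact mul_le_mul_of_nonneg_right (re_kingPlaq_fluxLink K p hν x).le (sq_nonneg _)) ?_
  rw [plaqGap_cos (abs_sOf_le K p ν₀), zero_add]
  exact mul_pos (mul_pos two_pos hc) (fluxGap_pos K hp)

open scoped Matrix.Norms.L2Operator in
/-- ★★★ **`‖(−cΔ_U+m²)⁻¹‖_{ℓ²→ℓ²} ≤ (m² + 2c(2−2cos(p′_{ν₀}∕4)))⁻¹`** at the constant-flux field whenever the right side is positive — e.g. `m² = 0`, `c > 0`, `p_{ν₀} ≠ 0`: the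
massless covariance at non-zero flux is bounded by the inverse curvature mass, uniformly in the volume. [cite: DodziukMathai2006, Cor 1.3 §1; Balaban1985BackgroundPropagators, (3.39) p.397] -/
theorem l2_opNorm_covLapF_fluxLink_inv_le (hc : 0 ≤ c) {m2 : ℝ} (p : Tor K) {ν₀ ν₁ : Fin (d + 1)} (hν : ν₀ ≠ ν₁)
    (hpos : 0 < m2 + 2 * c * (2 - 2 * Real.cos (sOf K p ν₀ / 4))) :
    ‖(covLapF K c m2 (fluxLink K p ν₁))⁻¹‖ ≤ (m2 + 2 * c * (2 - 2 * Real.cos (sOf K p ν₀ / 4)))⁻¹ := by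
  have hpos' : 0 < m2 + 2 * c * plaqGap (Real.cos (sOf K p ν₀)) := by rwa [plaqGap_cos (abs_sOf_le K p ν₀)]
  have h := l2_opNorm_covLapF_inv_le_of_plaq K hc (m2 := m2) (fluxLink_mem_unitaryGroup K p ν₁) hν (γ := Real.cos (sOf K p ν₀))
    (fun x u => by rw [re_inner_plaq_unit]; exact mul_le_mul_of_nonneg_right (re_kingPlaq_fluxLink K p hν x).le (sq_nonneg _)) hpos'
  rwa [plaqGap_cos (abs_sOf_le K p ν₀)] at h

open scoped Matrix.Norms.L2Operator in
/-- ★★ THE MASSLESS CASE spelled out: `‖(−cΔ_U)⁻¹‖ ≤ (2c(2−2cos(p′_{ν₀}∕4)))⁻¹` (`c > 0`, `p_{ν₀} ≠ 0`). [cite: DodziukMathai2006, Cor 1.3 §1; tHooft1979Flux, NPB 153 (flux sectors, notion)] -/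
theorem l2_opNorm_covLapF_fluxLink_massless_inv_le (hc : 0 < c) {p : Tor K} {ν₀ ν₁ : Fin (d + 1)} (hν : ν₀ ≠ ν₁) (hp : p ν₀ ≠ 0) :
    ‖(covLapF K c 0 (fluxLink K p ν₁))⁻¹‖ ≤ (2 * c * (2 - 2 * Real.cos (sOf K p ν₀ / 4)))⁻¹ := by
  have h := l2_opNorm_covLapF_fluxLink_inv_le K hc.le (m2 := 0) p hν (by rw [zero_add]; exact mul_pos (mul_pos two_pos hc) (fluxGap_pos K hp))
  rwa [zero_add] at h

end Flux

/-! ## §3 Contrast: the flat sector has `Re P = 1` -/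

section Flat

/-- At a TORON (constant link field, PARTS Ͷ∕Ͻ) every plaquette is `1`: `Re P = 1`, `λ(1) = 0` — the plaquette road sees no curvature there (correctly: the toron gap is the global holonomy
gap of Ͷ-d, not a local one). [cite: King1986, (2.12) p.653] -/
theorem re_kingPlaq_toronLink {ω : Fin (d + 1) → ℂ} (hω : ∀ μ, ‖ω μ‖ = 1) (x : Tor K) (μ ν : Fin (d + 1)) :
    (kingPlaq K (toronLink K ω) x μ ν () ()).re = 1 ∧ plaqGap ((kingPlaq K (toronLink K ω) x μ ν () ()).re) = 0 := by
  rw [kingPlaq_toronLink K hω x μ ν, Matrix.one_apply_eq, Complex.one_re, plaqGap_one]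
  exact ⟨rfl, rfl⟩

/-- At King's `U ≡ 1` (the free field) likewise `Re P = 1` and `λ = 0`. [cite: King1986, (4.4) p.670] -/
theorem re_kingPlaq_free (x : Tor K) (μ ν : Fin (d + 1)) :
    (kingPlaq K (Hopping.free : Tor K × Fin (d + 1) → Matrix Unit Unit ℂ) x μ ν () ()).re = 1
      ∧ plaqGap ((kingPlaq K (Hopping.free : Tor K × Fin (d + 1) → Matrix Unit Unit ℂ) x μ ν () ()).re) = 0 := by
  rw [kingPlaq_free K x μ ν, Matrix.one_apply_eq, Complex.one_re, plaqGap_one]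
  exact ⟨rfl, rfl⟩

end Flat

end Summit.QuantumFields.YangMills.BalabanUVNodes.N15KingModelRung.Curvature

end
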